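import Mathlib.Analysis.SpecialFunctions.Pow.Real
import HarnessLib

/-!
# Route `UnitScaleTilt`, crux K1 «MinimiserStabilityRegPr» (stmt-QuantumFields-19200), route-R E′ (A′)-on-Σ, P-A2 (β), row «(n3)-comb» —
# (O2) GROUNDWORK, file F-8c-final-1a: THE SLOT LETTERS OF THE `hMc` KNIT (pure reals)

«(O2) groundwork — not consumed by any displayed row before the freeze lifts» (★★OWNER `ym3-torus-plan` g29∕g30 RULINGS №20 (2), №22 (c) «(II) GO»).
Cell `ym3-torus`, D-0154 (3c) R3 twin-width seat `ym-routeR-w1` (gen 10); pen F-8c-final (★routeR-w6 g9), sub-file «letters» typed to the interface posted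
2026-08-29 11:58Z ((L1) exponent dictionary, (L2) geometric rows with frozen letters, (L3) constants by equality, (L4) slot conversion; (L5) is file 1b); ★routeR-w6 g9's «GO letters» 11:59Z with interface wishes W1–W4.  THEOREMS ONLY (0 `def`, 0 `sorry`); Mathlib-only;
`--supports stmt-QuantumFields-19200 --as helper`, count-neutral.  YM₃ on T³ is a ladder rung (R3), not the Clay problem; nothing here claims `hMcomb`, (β),
`hPA2`, the stub, the crux, d = 4 or the mass gap.  Pure real bookkeeping.

THE POINT.  The cell theorem F-8b-4 v2 (`Prop7CornerCombCellTheoremMember.sum_cell_normSq_tild_le_two_slot`) bounds the comb tower's level mass over a period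
cell by `2·A_y²·(ρˡ)² + 2·B_y²·((ρ⁻¹)ˡ)²`, `ρ = (√L)⁻¹`, with `A_y ∝ m₀` (the level-0 cell mass) and `B_y ∝ cB0 ∝ Ĝ♯ = g₀ + θ_g·e′·m₀·ρ^{2k}·ρ³∕(1−ρ²)` (the
level-0 covariant gradient plus the TOP-ANCHORED curvature feed, `ρ^{2k} = (Lᵏ)⁻¹ = ℓ⁻¹`).  G3's displayed row `hMc` (✓`Prop7HDOfCombRows.hD_of_hMcomb`) wants
`A·M·(Lˡ)⁻¹ + (B·(CURL + DIV) + B′·ℓ⁻²·M)·Lˡ` with `A B B′` chosen before `F n K e W X`.  This file is the dictionary between the two shapes: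
§1 the exponent letters at `ρ = (√L)⁻¹` (`(Lʲ·(Lᵏ)⁻¹)² = ρ^{4(k−j)}`, `(L^{k−j})⁻¹ = ρ^{2(k−j)}`, `ρ^{4k} = ((Lᵏ)²)⁻¹`; the anchor `ρ^{2k} = (Lᵏ)⁻¹` itself is px18 g5's ✓`Prop7CornerCombLambdaClosureSharp.rho_anchor_T3`, not restated) — the windows of
✓F-8c-3a∕✓F-8c-3b read in the `ρ^{4(k−j)}`∕`ρ^{2(k−j)}` letters of F-8b-4's `hκgeo`∕`hKgeo`∕`hσgeo`∕`hwMgeo`; §2 the three constants `cA cB0 cB1` BY EQUALITY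
(`hcAsq`, `hcB0sq` (v2, top-anchored), `hcB1sq` then hold as `(√x)² = x`); §3 the two letters `A_y = C_A·m₀`, `B_y = C_B·cB0` as ring identities; §4 ★ the slot
conversion: with `m₀² ≤ M` and `g₀² ≤ 8·CURL + 2·DIV + c_X·ℓ⁻²·M` (✓F-8c-2 `cellMass_Y0_le_of_in19_T3`, `cellGrad_tildIter_zero_le_of_regPr_of_in19_T3`),
`2(C_A m₀)²(Lˡ)⁻¹ + 2(C_B cB0)²Lˡ ≤ A·M·(Lˡ)⁻¹ + (B·(CURL + DIV) + B′·ℓ⁻²·M)·Lˡ` with `A = 2C_A²`, `B = 32·C_B²·c₀`, `B′ = 4·C_B²·c₀·(c_X + C_G²)`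
(`c₀ = 2wG·ρ∕(1−ρ)`, `C_G = θ_g·e′·ρ³∕(1−ρ²)`); §5 the geometric rows `hκgeo`∕`hKgeo`∕`hσgeo`∕`hwMgeo` of F-8b-4 from level windows
`a_j ≤ aC·ρ^{4(k−j)}`, `μ_j ≤ μC·ρ^{2(k−j)}` with the Greek letters FROZEN at the cap `eC` (the windows are monotone in `e ≤ eC`, so `A B B′` never see `e` — W3);
the smallness at `eC` (W2) and the member instantiation are F-8c-final-1's second file `…CombLevelMassMemberT3Letters` (independent, Mathlib-only).
HONEST SCOPE.  Pure real identities and monotone bookkeeping; every analytic input is a hypothesis of the consumer; nothing of F-8b∕F-8c-final is proved here.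

References: T. Bałaban, CMP **109** (1987) 249–301 [Balaban1987RG1] ((0.1), (0.4) pp.251–253: the two-slot inductive level bounds); CMP **102** (1985) 277–309
[Balaban1985Variational] ((2) p.278, (106)–(111) p.294: the `(Lˡ)⁻¹`∕`Lˡ` currency of the averaged fields).
-/

set_option autoImplicit false

noncomputable section

namespace Summit.QuantumFields.YangMills.Theorems.Prop7CombLevelMassSlotLetters

/-! ## §1 The exponent dictionary at `ρ = (√L)⁻¹` -/

/-- `((√L)⁻¹)² = L⁻¹` (`0 < L`). [folklore] -/
theorem rho_sq {L : ℝ} (hL : 0 < L) : ((Real.sqrt L)⁻¹) ^ 2 = L⁻¹ := by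
  rw [inv_pow, Real.sq_sqrt hL.le]

/-- `((√L)⁻¹)^{4m} = ((Lᵐ)²)⁻¹` (`0 < L`): the squared top anchor `ρ^{4k} = ℓ⁻²` of the `B′` slot. [cite: Balaban1985Variational, (2) p.278] -/
theorem rho_pow_four_mul {L : ℝ} (hL : 0 < L) (m : ℕ) : ((Real.sqrt L)⁻¹) ^ (4 * m) = ((L ^ m) ^ 2)⁻¹ := by
  rw [show 4 * m = 2 * (2 * m) by ring, pow_mul, rho_sq hL, inv_pow, ← pow_mul, mul_comm m 2, pow_mul, ← inv_pow]

/-- `(L^{k−j})⁻¹ = ((√L)⁻¹)^{2(k−j)}` (`0 < L`): the perturbation windows `μ_j = c·(L^{k−j})⁻¹` (✓F-8c-3b `mu_level_eq_inv_pow`) in the `ρ^{2(k−j)}` letter of `hσgeo`.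
[cite: Balaban1985Variational, (2), (5) p.278] -/
theorem inv_pow_eq_rho_pow {L : ℝ} (hL : 0 < L) (j k : ℕ) : (L ^ (k - j))⁻¹ = ((Real.sqrt L)⁻¹) ^ (2 * (k - j)) := by
  rw [pow_mul, rho_sq hL, inv_pow]

/-- `(Lʲ·(Lᵏ)⁻¹)² = ((√L)⁻¹)^{4(k−j)}` for `j ≤ k` (`0 < L`): the plaquette windows `a_j = 4ε₀·(Lʲ·(Lᵏ)⁻¹)²` (✓F-8c-3a `level_data_of_regPr`) in the `ρ^{4(k−j)}` letter of
`hκgeo`∕`hKgeo`∕`hwMgeo`. [cite: Balaban1985Averaging, (52)–(54) p.26; Balaban1985Variational, (14) p.280] -/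
theorem level_ratio_sq_eq_rho_pow {L : ℝ} (hL : 0 < L) {j k : ℕ} (hj : j ≤ k) :
    (L ^ j * (L ^ k)⁻¹) ^ 2 = ((Real.sqrt L)⁻¹) ^ (4 * (k - j)) := by
  have hL0 : L ≠ 0 := hL.ne'
  have hsplit : L ^ k = L ^ j * L ^ (k - j) := by rw [← pow_add, Nat.add_sub_cancel' hj]
  have hratio : L ^ j * (L ^ k)⁻¹ = (L ^ (k - j))⁻¹ := by
    rw [hsplit, mul_inv, ← mul_assoc, mul_inv_cancel₀ (pow_ne_zero _ hL0), one_mul]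
  rw [hratio, inv_pow_eq_rho_pow hL j k, ← pow_mul]
  congr 1
  ring

/-- The level-uniform reading: `((√L)⁻¹)^{m} ≤ 1` (`1 ≤ L`). [folklore] -/
theorem rho_pow_le_one {L : ℝ} (hL : 1 ≤ L) (m : ℕ) : ((Real.sqrt L)⁻¹) ^ m ≤ 1 := by
  have hs : 1 ≤ Real.sqrt L := by rw [← Real.sqrt_one]; exact Real.sqrt_le_sqrt hL
  exact pow_le_one₀ (inv_nonneg.mpr (Real.sqrt_nonneg _)) (inv_le_one_of_one_le₀ hs)

/-! ## §2 The three constants by equality -/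

/-- `(√x·t)² = x·t²` for `0 ≤ x`. [folklore] -/
theorem sq_sqrt_mul {x : ℝ} (hx : 0 ≤ x) (t : ℝ) : (Real.sqrt x * t) ^ 2 = x * t ^ 2 := by
  rw [mul_pow, Real.sq_sqrt hx]

/-- **`cA` BY EQUALITY**: with `cA := √(2(ΘM + 3wSθ₂²)·ρ∕(1−ρ))·(e′·m₀)`, F-8b-4's `hcAsq` holds (as an equality). [bookkeeping] -/
theorem hcAsq_of_choice {ΘM wS θ₂ ρ E m₀ : ℝ} (hΘ : 0 ≤ ΘM + 3 * wS * θ₂ ^ 2) (hρ0 : 0 ≤ ρ) (hρ1 : ρ < 1) :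
    2 * ((ΘM + 3 * wS * θ₂ ^ 2) * (E * m₀) ^ 2) * (ρ / (1 - ρ))
      ≤ (Real.sqrt (2 * (ΘM + 3 * wS * θ₂ ^ 2) * (ρ / (1 - ρ))) * (E * m₀)) ^ 2 := by
  have hx : 0 ≤ 2 * (ΘM + 3 * wS * θ₂ ^ 2) * (ρ / (1 - ρ)) := by
    have : 0 ≤ ρ / (1 - ρ) := div_nonneg hρ0 (by linarith)
    positivity
  rw [sq_sqrt_mul hx]
  exact le_of_eq (by ring)

/-- **`cB0` BY EQUALITY (v2, TOP-ANCHORED)**: with `cB0 := √(2wG·ρ∕(1−ρ))·(g₀ + θ_g·e′·m₀·ρ^{2k}·ρ³∕(1−ρ²))`, F-8b-4 v2's `hcB0sq` holds (as an equality).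
[bookkeeping] -/
theorem hcB0sq_of_choice {wG θg ρ E m₀ g₀ : ℝ} (hwG : 0 ≤ wG) (hρ0 : 0 ≤ ρ) (hρ1 : ρ < 1) (k : ℕ) :
    2 * wG * (g₀ + θg * E * m₀ * ρ ^ (2 * k) * (ρ ^ 3 / (1 - ρ ^ 2))) ^ 2 * (ρ / (1 - ρ))
      ≤ (Real.sqrt (2 * wG * (ρ / (1 - ρ))) * (g₀ + θg * E * m₀ * ρ ^ (2 * k) * (ρ ^ 3 / (1 - ρ ^ 2)))) ^ 2 := by
  have hx : 0 ≤ 2 * wG * (ρ / (1 - ρ)) := by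
    have : 0 ≤ ρ / (1 - ρ) := div_nonneg hρ0 (by linarith)
    positivity
  rw [sq_sqrt_mul hx]
  exact le_of_eq (by ring)

/-- **`cB1` BY EQUALITY**: with `cB1 := √(2(wN·ρ∕(1−ρ) + (ΘM + 3wSθ₂²)·ρ⁵∕(1−ρ⁵)))`, F-8b-4's `hcB1sq` holds (as an equality). [bookkeeping] -/
theorem hcB1sq_of_choice {wN ΘM wS θ₂ ρ : ℝ} (hwN : 0 ≤ wN) (hΘ : 0 ≤ ΘM + 3 * wS * θ₂ ^ 2) (hρ0 : 0 ≤ ρ) (hρ1 : ρ < 1) :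
    2 * (wN * (ρ / (1 - ρ)) + (ΘM + 3 * wS * θ₂ ^ 2) * (ρ ^ 5 / (1 - ρ ^ 5)))
      ≤ (Real.sqrt (2 * (wN * (ρ / (1 - ρ)) + (ΘM + 3 * wS * θ₂ ^ 2) * (ρ ^ 5 / (1 - ρ ^ 5))))) ^ 2 := by
  have hρ5 : ρ ^ 5 < 1 := pow_lt_one₀ hρ0 hρ1 (by norm_num)
  have hx : 0 ≤ 2 * (wN * (ρ / (1 - ρ)) + (ΘM + 3 * wS * θ₂ ^ 2) * (ρ ^ 5 / (1 - ρ ^ 5))) := by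
    have h1 : 0 ≤ ρ / (1 - ρ) := div_nonneg hρ0 (by linarith)
    have h5 : 0 ≤ ρ ^ 5 / (1 - ρ ^ 5) := div_nonneg (by positivity) (by linarith)
    positivity
  rw [Real.sq_sqrt hx]

/-- The three chosen constants are nonnegative (F-8b-4's `hcA`, `hcB0`, `hcB1`), given `0 ≤ e′·m₀`-type factors. [bookkeeping] -/
theorem sqrt_mul_nonneg {x t : ℝ} (ht : 0 ≤ t) : 0 ≤ Real.sqrt x * t :=
  mul_nonneg (Real.sqrt_nonneg _) ht

/-! ## §3 The two letters of the two-slot output -/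

/-- **THE A-LETTER IS LINEAR IN `m₀`**: with `cA = C_cA·(e′·m₀)`, F-8b-4's A-coefficient equals `C_A·m₀`,
`C_A = e′·(1 + C_cA)·(1 + (1 + cB1)·2e′θ₂·ρ∕(1−ρ²))`. [bookkeeping] -/
theorem A_letter_eq {E θ₂ ρ cB1 CcA m₀ : ℝ} :
    (E * m₀ + 2 * E * θ₂ * (E * m₀ + CcA * (E * m₀)) * (ρ / (1 - ρ ^ 2))
        + (CcA * (E * m₀) + cB1 * (2 * E * θ₂ * (E * m₀ + CcA * (E * m₀)) * (ρ / (1 - ρ ^ 2)))))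
      = (E * (1 + CcA) * (1 + (1 + cB1) * (2 * E * θ₂ * (ρ / (1 - ρ ^ 2))))) * m₀ := by
  ring

/-- **THE B-LETTER IS LINEAR IN `cB0`**: F-8b-4's B-coefficient equals `C_B·cB0`, `C_B = 1 + (1 + cB1)·2e′θ₂·ρ³∕(1−ρ⁴)`. [bookkeeping] -/
theorem B_letter_eq {E θ₂ ρ cB0 cB1 : ℝ} :
    (2 * E * θ₂ * cB0 * (ρ ^ 3 / (1 - ρ ^ 4)) + (cB0 + cB1 * (2 * E * θ₂ * cB0 * (ρ ^ 3 / (1 - ρ ^ 4)))))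
      = (1 + (1 + cB1) * (2 * E * θ₂ * (ρ ^ 3 / (1 - ρ ^ 4)))) * cB0 := by
  ring

/-! ## §4 ★ The slot conversion -/

/-- ★ **THE SLOT CONVERSION.**  Reals: a level mass `S`, the level-0 letters `m₀ g₀`, the member currencies `M CURL` and `DIV ≥ 0`, the two exponent readings
`Ll = Lˡ ≥ 0`, `Llinv = (Lˡ)⁻¹ ≥ 0`, the squared top anchor `r2k² = ell2inv` (`r2k = ρ^{2k}`, `ell2inv = ((L^{K−n})²)⁻¹`), the letters `C_A`, `C_B`, `c₀ ≥ 0` (`= 2wGρ∕(1−ρ)`),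
`C_G` (`= θ_g·e′·ρ³∕(1−ρ²)`), `c_X ≥ 0`.  HYPOTHESES: the two-slot bound `S ≤ 2(C_A m₀)²·Llinv + 2(C_B cB0)²·Ll` with `cB0 = √c₀·(g₀ + C_G·r2k·m₀)` (§2∕§3), the
level-0 currencies `m₀² ≤ M` and `g₀² ≤ 8·CURL + 2·DIV + c_X·ell2inv·M` (✓F-8c-2).  CONCLUSION — THE `hMc` SHAPE:
`S ≤ (2C_A²)·M·Llinv + ((32·C_B²·c₀)·(CURL + DIV) + (4·C_B²·c₀·(c_X + C_G²))·ell2inv·M)·Ll`.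
[cite: Balaban1987RG1, (0.4) p.253; Balaban1985Variational, (2) p.278, (110)–(111) p.294] -/
theorem two_slot_to_hMc_slots {S m₀ g₀ M CURL DIV Ll Llinv r2k ell2inv CA CB c₀ CG cX cB0 : ℝ}
    (hDIV : 0 ≤ DIV) (hLl : 0 ≤ Ll) (hLlinv : 0 ≤ Llinv)
    (hc₀ : 0 ≤ c₀) (hell : 0 ≤ ell2inv) (hr : r2k ^ 2 = ell2inv)
    (hcB0 : cB0 = Real.sqrt c₀ * (g₀ + CG * r2k * m₀))
    (hm : m₀ ^ 2 ≤ M) (hg : g₀ ^ 2 ≤ 8 * CURL + 2 * DIV + cX * ell2inv * M)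
    (hS : S ≤ 2 * ((CA * m₀) ^ 2 * Llinv) + 2 * ((CB * cB0) ^ 2 * Ll)) :
    S ≤ (2 * CA ^ 2) * M * Llinv + ((32 * CB ^ 2 * c₀) * (CURL + DIV) + (4 * CB ^ 2 * c₀ * (cX + CG ^ 2)) * ell2inv * M) * Ll := by
  -- the A-slot
  have hA : (CA * m₀) ^ 2 * Llinv ≤ CA ^ 2 * M * Llinv := by
    have h1 : (CA * m₀) ^ 2 = CA ^ 2 * m₀ ^ 2 := by ring
    rw [h1]
    exact mul_le_mul_of_nonneg_right (mul_le_mul_of_nonneg_left hm (sq_nonneg _)) hLlinv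
  -- the B-slot: `cB0² = c₀·(g₀ + C_G r2k m₀)² ≤ c₀·(2g₀² + 2C_G² ell2inv m₀²)`
  have hcB0sq : cB0 ^ 2 = c₀ * (g₀ + CG * r2k * m₀) ^ 2 := by rw [hcB0, sq_sqrt_mul hc₀]
  have hsum : (g₀ + CG * r2k * m₀) ^ 2 ≤ 2 * g₀ ^ 2 + 2 * (CG ^ 2 * ell2inv * m₀ ^ 2) := by
    have : (g₀ + CG * r2k * m₀) ^ 2 ≤ 2 * g₀ ^ 2 + 2 * (CG * r2k * m₀) ^ 2 := by nlinarith [sq_nonneg (g₀ - CG * r2k * m₀)]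
    have e1 : (CG * r2k * m₀) ^ 2 = CG ^ 2 * ell2inv * m₀ ^ 2 := by rw [← hr]; ring
    linarith
  have hgm : 2 * g₀ ^ 2 + 2 * (CG ^ 2 * ell2inv * m₀ ^ 2) ≤ 16 * (CURL + DIV) + 2 * (cX + CG ^ 2) * ell2inv * M := by
    have h2 : CG ^ 2 * ell2inv * m₀ ^ 2 ≤ CG ^ 2 * ell2inv * M := mul_le_mul_of_nonneg_left hm (by positivity)
    nlinarith
  have hB : (CB * cB0) ^ 2 * Ll ≤ CB ^ 2 * c₀ * (16 * (CURL + DIV) + 2 * (cX + CG ^ 2) * ell2inv * M) * Ll := by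
    have h1 : (CB * cB0) ^ 2 = CB ^ 2 * c₀ * (g₀ + CG * r2k * m₀) ^ 2 := by rw [mul_pow, hcB0sq]; ring
    rw [h1]
    exact mul_le_mul_of_nonneg_right (mul_le_mul_of_nonneg_left (hsum.trans hgm) (by positivity)) hLl
  calc S ≤ 2 * ((CA * m₀) ^ 2 * Llinv) + 2 * ((CB * cB0) ^ 2 * Ll) := hS
    _ ≤ 2 * (CA ^ 2 * M * Llinv) + 2 * (CB ^ 2 * c₀ * (16 * (CURL + DIV) + 2 * (cX + CG ^ 2) * ell2inv * M) * Ll) := by linarith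
    _ = _ := by ring

/-- The `0 ≤` certificates of the three `hMc` constants (`∃ eC A B B′, 0 < eC ∧ 0 ≤ A ∧ 0 ≤ B ∧ 0 ≤ B′ ∧ …`). [bookkeeping] -/
theorem hMc_constants_nonneg {CA CB c₀ CG cX : ℝ} (hc₀ : 0 ≤ c₀) (hcX : 0 ≤ cX) :
    0 ≤ 2 * CA ^ 2 ∧ 0 ≤ 32 * CB ^ 2 * c₀ ∧ 0 ≤ 4 * CB ^ 2 * c₀ * (cX + CG ^ 2) := by
  refine ⟨by positivity, by positivity, by positivity⟩


/-! ## §5 The geometric rows with FROZEN letters (windows monotone in `e ≤ eC`) -/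

/-- **PLAQUETTE WINDOWS, FROZEN**: `a_j(ε₀) = 2·(2ε₀·(Lʲ(Lᵏ)⁻¹)²) ≤ (2·(2ε₀C))·ρ^{4(k−j)}` for `ε₀ ≤ ε₀C`, `j ≤ k`, `ρ = (√L)⁻¹` (✓F-8c-3a's `a_k` letter read in
F-8b-4's `ρ^{4(k−j)}` letter, at the frozen window). [cite: Balaban1985Averaging, (52)–(54) p.26; Balaban1985Variational, (14) p.280] -/
theorem a_level_le_frozen {L ε₀ ε₀C : ℝ} (hL : 0 < L) (hεC : ε₀ ≤ ε₀C) {j k : ℕ} (hj : j ≤ k) :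
    2 * (2 * ε₀ * (L ^ j * (L ^ k)⁻¹) ^ 2) ≤ 2 * (2 * ε₀C) * ((Real.sqrt L)⁻¹) ^ (4 * (k - j)) := by
  rw [← level_ratio_sq_eq_rho_pow hL hj]
  have hX : 0 ≤ (L ^ j * (L ^ k)⁻¹) ^ 2 := sq_nonneg _
  nlinarith [mul_le_mul_of_nonneg_right hεC hX]

/-- **TWO-BLOCK WINDOWS, FROZEN**: `C·δ·(L^{k−j})⁻¹ ≤ (C·δC)·ρ^{2(k−j)}` for `δ ≤ δC`, `0 ≤ C` (✓F-8c-3b's `μ_j = 9360L³δ(L^{K−n−j})⁻¹`, `mu_level_eq_inv_pow`,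
read in F-8b-4's `ρ^{2(k−j)}` letter). [cite: Balaban1985Averaging, (124)–(126) p.36; Balaban1985Variational, (5) p.278] -/
theorem mu_level_le_frozen {L C δ δC : ℝ} (hL : 0 < L) (hC : 0 ≤ C) (hδC : δ ≤ δC) (j k : ℕ) :
    C * δ * (L ^ (k - j))⁻¹ ≤ C * δC * ((Real.sqrt L)⁻¹) ^ (2 * (k - j)) := by
  rw [← inv_pow_eq_rho_pow hL j k]
  have hX : 0 ≤ (L ^ (k - j))⁻¹ := inv_nonneg.mpr (pow_nonneg hL.le _)
  exact mul_le_mul_of_nonneg_right (mul_le_mul_of_nonneg_left hδC hC) hX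

/-- **`hκgeo` FROM THE WINDOWS**: if `α_j = 2(8(d+1)(d+4)L²·a_j)` and `a_j ≤ aC·ρ^{4(k−j)}` (`j < k`), then F-8b-4's `hκgeo` holds with the frozen letter
`θ′ := 210((2d+2)L)·(2(8(d+1)(d+4)L²·aC))·√(2d)`. [cite: Balaban1985Averaging, (42)–(47) pp.23–25, Prop. 3 (122)–(126) p.36] -/
theorem kappa_geo_of_windows {d : ℕ} {L ρ aC : ℝ} (hL : 0 ≤ L) {k : ℕ} {a α : ℕ → ℝ}
    (hα : ∀ j, α j = 2 * (8 * ((d : ℝ) + 1) * ((d : ℝ) + 4) * L ^ 2 * a j)) (ha : ∀ j < k, a j ≤ aC * ρ ^ (4 * (k - j))) :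
    ∀ j < k, 210 * ((2 * d + 2) * L) * α j * Real.sqrt (2 * d)
      ≤ (210 * ((2 * d + 2) * L) * (2 * (8 * ((d : ℝ) + 1) * ((d : ℝ) + 4) * L ^ 2 * aC)) * Real.sqrt (2 * d)) * ρ ^ (4 * (k - j)) := by
  intro j hj
  have h1 : α j ≤ 2 * (8 * ((d : ℝ) + 1) * ((d : ℝ) + 4) * L ^ 2 * aC) * ρ ^ (4 * (k - j)) := by
    rw [hα]
    have := mul_le_mul_of_nonneg_left (ha j hj) (show 0 ≤ 2 * (8 * ((d : ℝ) + 1) * ((d : ℝ) + 4) * L ^ 2) by positivity)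
    linarith [this]
  have hc : 0 ≤ 210 * ((2 * (d : ℝ) + 2) * L) := by positivity
  have hs : 0 ≤ Real.sqrt (2 * d) := Real.sqrt_nonneg _
  calc 210 * ((2 * d + 2) * L) * α j * Real.sqrt (2 * d)
      = (210 * ((2 * (d : ℝ) + 2) * L) * Real.sqrt (2 * d)) * α j := by ring
    _ ≤ (210 * ((2 * (d : ℝ) + 2) * L) * Real.sqrt (2 * d)) * (2 * (8 * ((d : ℝ) + 1) * ((d : ℝ) + 4) * L ^ 2 * aC) * ρ ^ (4 * (k - j))) :=
        mul_le_mul_of_nonneg_left h1 (mul_nonneg hc hs)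
    _ = _ := by ring

/-- **`hKgeo` FROM THE WINDOWS**: with `α_j = 2(8(d+1)(d+4)L²·a_j)`, `0 ≤ a_j ≤ aC·ρ^{4(k−j)}` (`j < k`), F-8b-4's `hKgeo` holds with the frozen letter
`θ_g := (24·αC + 8((d+2)L)²·aC)·√(d·(L²(Lᵈ)⁻¹)) + 210((2d+2)L)·αC·√(8d²)`, `αC = 2(8(d+1)(d+4)L²·aC)`. [cite: Balaban1985Averaging, (42)–(47) pp.23–25, (65) p.29] -/
theorem K_geo_of_windows {d : ℕ} {L ρ aC : ℝ} (hL : 0 ≤ L) {k : ℕ} {a α : ℕ → ℝ}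
    (hα : ∀ j, α j = 2 * (8 * ((d : ℝ) + 1) * ((d : ℝ) + 4) * L ^ 2 * a j)) (ha : ∀ j < k, a j ≤ aC * ρ ^ (4 * (k - j))) :
    ∀ j < k, (24 * α j + 8 * (((d : ℝ) + 2) * L) ^ 2 * a j) * Real.sqrt (d * (L ^ 2 * (L ^ d)⁻¹))
        + 210 * ((2 * d + 2) * L) * α j * Real.sqrt (8 * (d : ℝ) ^ 2)
      ≤ ((24 * (2 * (8 * ((d : ℝ) + 1) * ((d : ℝ) + 4) * L ^ 2 * aC)) + 8 * (((d : ℝ) + 2) * L) ^ 2 * aC) * Real.sqrt (d * (L ^ 2 * (L ^ d)⁻¹))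
          + 210 * ((2 * d + 2) * L) * (2 * (8 * ((d : ℝ) + 1) * ((d : ℝ) + 4) * L ^ 2 * aC)) * Real.sqrt (8 * (d : ℝ) ^ 2)) * ρ ^ (4 * (k - j)) := by
  intro j hj
  set X : ℝ := ρ ^ (4 * (k - j)) with hX
  have haj : a j ≤ aC * X := ha j hj
  have hαj : α j ≤ 2 * (8 * ((d : ℝ) + 1) * ((d : ℝ) + 4) * L ^ 2 * aC) * X := by
    rw [hα]
    have := mul_le_mul_of_nonneg_left haj (show 0 ≤ 2 * (8 * ((d : ℝ) + 1) * ((d : ℝ) + 4) * L ^ 2) by positivity)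
    linarith [this]
  have hs1 : 0 ≤ Real.sqrt (d * (L ^ 2 * (L ^ d)⁻¹)) := Real.sqrt_nonneg _
  have hs2 : 0 ≤ Real.sqrt (8 * (d : ℝ) ^ 2) := Real.sqrt_nonneg _
  have hc1 : 0 ≤ 8 * (((d : ℝ) + 2) * L) ^ 2 := by positivity
  have hc2 : 0 ≤ 210 * ((2 * (d : ℝ) + 2) * L) := by positivity
  have p1 : (24 * α j + 8 * (((d : ℝ) + 2) * L) ^ 2 * a j) * Real.sqrt (d * (L ^ 2 * (L ^ d)⁻¹))
      ≤ (24 * (2 * (8 * ((d : ℝ) + 1) * ((d : ℝ) + 4) * L ^ 2 * aC) * X) + 8 * (((d : ℝ) + 2) * L) ^ 2 * (aC * X))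
          * Real.sqrt (d * (L ^ 2 * (L ^ d)⁻¹)) :=
    mul_le_mul_of_nonneg_right (add_le_add (by linarith) (mul_le_mul_of_nonneg_left haj hc1)) hs1
  have p2 : 210 * ((2 * d + 2) * L) * α j * Real.sqrt (8 * (d : ℝ) ^ 2)
      ≤ 210 * ((2 * d + 2) * L) * (2 * (8 * ((d : ℝ) + 1) * ((d : ℝ) + 4) * L ^ 2 * aC) * X) * Real.sqrt (8 * (d : ℝ) ^ 2) :=
    mul_le_mul_of_nonneg_right (mul_le_mul_of_nonneg_left hαj hc2) hs2
  have := add_le_add p1 p2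
  refine this.trans (le_of_eq ?_)
  ring

/-- **`hσgeo` FROM THE WINDOWS**: if `μ_j ≤ μC·ρ^{2(k−j)}` (`j < k`), then F-8b-4's `hσgeo` holds with the frozen letter `θ₂ := 260·μC·((2d+2)L)·√(2d)`.
[cite: Balaban1985Averaging, Prop. 3 (122)–(126) p.36] -/
theorem sigma_geo_of_windows {d : ℕ} {L ρ μC : ℝ} (hL : 0 ≤ L) {k : ℕ} {μ : ℕ → ℝ}
    (hμ : ∀ j < k, μ j ≤ μC * ρ ^ (2 * (k - j))) :
    ∀ j < k, 260 * μ j * ((2 * d + 2) * L) * Real.sqrt (2 * d) ≤ (260 * μC * ((2 * d + 2) * L) * Real.sqrt (2 * d)) * ρ ^ (2 * (k - j)) := by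
  intro j hj
  have hc : 0 ≤ 260 * ((2 * (d : ℝ) + 2) * L) * Real.sqrt (2 * d) := by positivity
  calc 260 * μ j * ((2 * d + 2) * L) * Real.sqrt (2 * d) = (260 * ((2 * (d : ℝ) + 2) * L) * Real.sqrt (2 * d)) * μ j := by ring
    _ ≤ (260 * ((2 * (d : ℝ) + 2) * L) * Real.sqrt (2 * d)) * (μC * ρ ^ (2 * (k - j))) := mul_le_mul_of_nonneg_left (hμ j hj) hc
    _ = _ := by ring

/-- **`hwMgeo` FROM A QUADRATIC WINDOW**: if `0 ≤ wM_j ≤ CΘ·(a_j)²`-type data with `0 ≤ a_j ≤ aC·ρ^{4(k−j)}` and `ρ^{4(k−j)} ≤ 1`, then `wM_j ≤ (CΘ·aC²)·ρ^{4(k−j)}`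
(one window power spent, one kept). [bookkeeping] -/
theorem wM_geo_of_sq_window {ρ aC CΘ : ℝ} (hρ0 : 0 ≤ ρ) (hρ1 : ρ ≤ 1) (hC : 0 ≤ CΘ) {k : ℕ} {a wM : ℕ → ℝ}
    (ha0 : ∀ j, 0 ≤ a j) (ha : ∀ j < k, a j ≤ aC * ρ ^ (4 * (k - j))) (hwM : ∀ j < k, wM j ≤ CΘ * (a j) ^ 2) :
    ∀ j < k, wM j ≤ (CΘ * aC ^ 2) * ρ ^ (4 * (k - j)) := by
  intro j hj
  have hX0 : 0 ≤ ρ ^ (4 * (k - j)) := by positivity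
  have hX1 : ρ ^ (4 * (k - j)) ≤ 1 := pow_le_one₀ hρ0 hρ1
  have h1 : a j ^ 2 ≤ (aC * ρ ^ (4 * (k - j))) ^ 2 := pow_le_pow_left₀ (ha0 j) (ha j hj) 2
  have h2 : (aC * ρ ^ (4 * (k - j))) ^ 2 ≤ aC ^ 2 * ρ ^ (4 * (k - j)) := by
    have : aC ^ 2 * (ρ ^ (4 * (k - j)) * ρ ^ (4 * (k - j))) ≤ aC ^ 2 * (ρ ^ (4 * (k - j)) * 1) :=
      mul_le_mul_of_nonneg_left (mul_le_mul_of_nonneg_left hX1 hX0) (sq_nonneg _)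
    nlinarith [this]
  calc wM j ≤ CΘ * (a j) ^ 2 := hwM j hj
    _ ≤ CΘ * (aC ^ 2 * ρ ^ (4 * (k - j))) := mul_le_mul_of_nonneg_left (h1.trans h2) hC
    _ = _ := by ring

/-- Monotone reading of the level-0 gradient currency: a larger `c_X` still bounds (`0 ≤ ell2inv`, `0 ≤ M`). [bookkeeping] -/
theorem grad_currency_mono {g₀sq CURL DIV cX cX' ell2inv M : ℝ} (h : g₀sq ≤ 8 * CURL + 2 * DIV + cX * ell2inv * M) (hc : cX ≤ cX')
    (hell : 0 ≤ ell2inv) (hM : 0 ≤ M) : g₀sq ≤ 8 * CURL + 2 * DIV + cX' * ell2inv * M := by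
  have := mul_le_mul_of_nonneg_right (mul_le_mul_of_nonneg_right hc hell) hM
  linarith

end Summit.QuantumFields.YangMills.Theorems.Prop7CombLevelMassSlotLetters

end
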